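import Summits.Ventures.PercRepro.Night2LocalS6Defs
import Summits.Ventures.PercRepro.Night2LocalSimpleCount3

/-!
# PercRepro — S6 columns, I: the large shadow sets (night-2, gen 9)

A shadow set `S` with `|S| ≥ 7` receives S6 weight only from its cover preimages `S ∖ {z}` (`z` a coloop of
`S`), each at most `5/12`; so its column is at most `(5/12)·#coloops(S)` — `≤ 5/6` when `S` has at most two
coloops (`card_coloops_le_two_of_simple` in a simple plane).
-/

namespace PercRepro.Shadow

open Finset PerFlat ThmH

variable {α : Type*} [DecidableEq α] {M : Matroid α} [M.Finite]

open scoped Classical in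
/-- An S6 weight on a covering set is at most `5/12`. -/
theorem s6W_le_of_mem_coverSets {G B S : Finset α} (hS : S ∈ coverSets M B G) : s6W M G B S ≤ 5 / 12 := by
  have hm : 1 ≤ (G \ clF M B).card := by
    obtain ⟨z, hz, -⟩ := mem_coverSets.1 hS
    exact Finset.card_pos.2 ⟨z, hz⟩
  have hnot : ¬ (B ∪ (G \ clF M B) ⊆ S ∧ S ⊆ G ∧ (S \ B).card = 2) := by
    rintro ⟨-, -, h2⟩
    obtain ⟨z, -, rfl⟩ := mem_coverSets.1 hS
    have : (insert z B \ B).card ≤ 1 := by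
      calc (insert z B \ B).card ≤ ({z} : Finset α).card := Finset.card_le_card (by
            intro e he
            rw [Finset.mem_sdiff, Finset.mem_insert] at he
            rw [Finset.mem_singleton]
            rcases he.1 with rfl | h
            · rfl
            · exact absurd h he.2)
        _ = 1 := Finset.card_singleton z
    omega
  unfold s6W
  simp only [hnot, if_false, add_zero, hS, if_true]
  by_cases hm1 : (G \ clF M B).card = 1
  · rw [if_pos hm1]
    by_cases h3 : B.card = 3
    · rw [if_pos h3]; norm_num
    · rw [if_neg h3]
      by_cases h4 : B.card = 4 ∧ ∃ e ∈ B, rkN M (B.erase e) = 2 ∧ (clF M B \ clF M (B.erase e)).card ≤ 3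
      · rw [if_pos h4]; norm_num
      · rw [if_neg h4]
  · rw [if_neg hm1]
    have hm2 : (2 : ℚ) ≤ ((G \ clF M B).card : ℚ) := by exact_mod_cast (by omega : 2 ≤ (G \ clF M B).card)
    rw [div_le_iff₀ (by linarith)]
    linarith

open scoped Classical in
/-- An S6 weight on a set with `|S| ≥ 7` that is not a covering set is `0`. -/
theorem s6W_eq_zero_of_seven_le {G B S : Finset α} (h7 : 7 ≤ S.card) (hS : S ∉ coverSets M B G) :
    s6W M G B S = 0 := by
  have hnot : B.card ≤ 4 → ¬ (B ∪ (G \ clF M B) ⊆ S ∧ S ⊆ G ∧ (S \ B).card = 2) := by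
    rintro hk4 ⟨hsub, -, h2⟩
    have hBS : B ⊆ S := (Finset.subset_union_left).trans hsub
    have := Finset.card_sdiff_add_card_eq_card hBS
    omega
  unfold s6W
  simp only [hS, if_false]
  by_cases hm1 : (G \ clF M B).card = 1
  · rw [if_pos hm1]
    by_cases h3 : B.card = 3
    · rw [if_pos h3, if_neg (hnot (by omega))]
    · rw [if_neg h3]
      by_cases h4 : B.card = 4 ∧ ∃ e ∈ B, rkN M (B.erase e) = 2 ∧ (clF M B \ clF M (B.erase e)).card ≤ 3
      · rw [if_pos h4, if_neg (hnot (by omega)), add_zero]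
      · rw [if_neg h4]
  · rw [if_neg hm1]

open scoped Classical in
/-- **Large columns**: for `|S| ≥ 7` the S6 column of `S` is at most `(5/12)·#coloops(S)`. -/
theorem sum_s6W_col_le_of_seven_le {𝒜 : Finset (Finset α)} (h𝒜 : 𝒜 ⊆ Uq M 5 3) (G : Finset α) {S : Finset α}
    (h7 : 7 ≤ S.card) :
    ∑ B ∈ membersIn M 𝒜 G, s6W M G B S ≤ (5 / 12) * ((coloops M S).card : ℚ) := by
  have hfilt : ∀ B ∈ membersIn M 𝒜 G, s6W M G B S =
      if B ∈ coverPreimages M 𝒜 G S then s6W M G B S else 0 := by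
    intro B hB
    by_cases h : S ∈ coverSets M B G
    · rw [if_pos (mem_coverPreimages.2 ⟨hB, h⟩)]
    · rw [if_neg (fun hc => h (mem_coverPreimages.1 hc).2), s6W_eq_zero_of_seven_le h7 h]
  rw [Finset.sum_congr rfl hfilt, ← Finset.sum_filter]
  have hsub : (membersIn M 𝒜 G).filter (fun B => B ∈ coverPreimages M 𝒜 G S) = coverPreimages M 𝒜 G S := by
    ext B
    rw [Finset.mem_filter]
    constructor
    · rintro ⟨-, h⟩; exact h
    · intro h; exact ⟨(mem_coverPreimages.1 h).1, h⟩
  rw [hsub]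
  calc ∑ B ∈ coverPreimages M 𝒜 G S, s6W M G B S ≤ ∑ B ∈ coverPreimages M 𝒜 G S, (5 / 12 : ℚ) :=
        Finset.sum_le_sum (fun B hB => s6W_le_of_mem_coverSets (mem_coverPreimages.1 hB).2)
    _ = (5 / 12) * ((coverPreimages M 𝒜 G S).card : ℚ) := by rw [Finset.sum_const, nsmul_eq_mul]; ring
    _ ≤ (5 / 12) * ((coloops M S).card : ℚ) := by
        have := card_coverPreimages_le_card_coloops (q := 3) h𝒜 G S
        gcongr

open scoped Classical in
/-- **Large columns in a simple plane**: `|S| ≥ 7`, `S = {y} ∪ T` with `y ∉ cl T` and `T` of pairwise-rank-`2`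
elements, `ρ(S) = 4`: the S6 column of `S` is at most `5/6`. -/
theorem sum_s6W_col_le_of_seven_le_of_simple {𝒜 : Finset (Finset α)} (h𝒜 : 𝒜 ⊆ Uq M 5 3) (G : Finset α)
    {S : Finset α} (hS : S ⊆ gr M) {y : α} (hy : y ∈ S) (hycl : y ∉ clF M (S.erase y))
    (hsimple : ∀ e ∈ S.erase y, ∀ f ∈ S.erase y, e ≠ f → rkN M {e, f} = 2) (hr : rkN M S = 4)
    (h7 : 7 ≤ S.card) : ∑ B ∈ membersIn M 𝒜 G, s6W M G B S ≤ 5 / 6 := by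
  have h4 : 4 ≤ (S.erase y).card := by
    rw [Finset.card_erase_of_mem hy]; omega
  have hc := card_coloops_le_two_of_simple hS hy hycl hsimple hr h4
  have hc' : ((coloops M S).card : ℚ) ≤ 2 := by exact_mod_cast hc
  calc ∑ B ∈ membersIn M 𝒜 G, s6W M G B S ≤ (5 / 12) * ((coloops M S).card : ℚ) :=
        sum_s6W_col_le_of_seven_le h𝒜 G h7
    _ ≤ (5 / 12) * 2 := by gcongr
    _ = 5 / 6 := by norm_num

end PercRepro.Shadow
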